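import Mathlib
import Summits.Ventures.HodgeRepro2.Tier7.Line3.NumberFieldHyperbolicCount

/-!
# Tier 7 — LINE 3 support: the `count_bound` field of `DominantSide` from a κ-dictionary
(`Line3/CountBoundOfKappa.lean`; t7-L1-p5, gen 1)

p1's version-(ii) shadow `DominantSide` (T7SupportDominantGeometricSide, row 674) has the field
`count_bound : ∃ C' : ℝ, ∀ N (R : ℝ), 0 ≤ R → ∃ s : Finset Orb, (∀ γ, arith N γ → size γ ≤ R → γ ∈ s) ∧ (s.card : ℝ) ≤ C' * (1 + R) ^ β`.
This file derives it, with `size γ := (1 + |κ γ − κ₀|_{w₂}) (1 + |κ γ − κ₀|_{w₃})` and `β := 1 + ε`, from a κ-DICTIONARY: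
an injective `κ : Orb → K` into a totally real number field (on the real objects the double-coset invariant, one double
coset per regular value — p1 TwoTorusInvariant), and `arith N γ → κ γ − κ₀ ∈ M⁻¹O_K ∧ |κ γ − κ₀|_w ≤ B off {w₂, w₃}` (x1's
integrality (c)/(d) + KappaDefiniteBound at the definite place), through the hyperbolic count
`NumberFieldHyperbolicCount.exists_finset_rpow` (p670521): for `R < 1` the set is empty (`size ≥ 1`), for `R ≥ 1` the
finset of p670521 is pulled back along `κ` (`Finset.preimage`). Uniform in the level `N`. Nothing about the real objects
beyond the displayed dictionary; no device.
Sorry-free; axioms: propext / Classical.choice / Quot.sound. §8(d): uses an L-value-free non-vanishing device: NO.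
-/

namespace Summit.Ventures.HodgeRepro2.Tier7.Line3.CountBoundOfKappa

open NumberField Summit.Ventures.HodgeRepro2.Tier7.Line3.NumberFieldHyperbolicCount

variable {K : Type*} [Field K] [NumberField K]

/-- **`count_bound` from a κ-dictionary**: with `size γ = (1 + |κ γ − κ₀|_{w₂})(1 + |κ γ − κ₀|_{w₃})` and `β = 1 + ε`. -/
theorem count_bound_of_kappa (hK : ∀ w : InfinitePlace K, w.IsReal) (M : K) (hM : M ≠ 0)
    {w₂ w₃ : InfinitePlace K} (hw : w₂ ≠ w₃) {ε : ℝ} (hε : 0 < ε) {B : ℝ} (hB : 0 ≤ B)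
    {Orb : Type} (κ : Orb → K) (hκ : Function.Injective κ) (κ₀ : K) (arith : ℕ → Orb → Prop)
    (hdict : ∀ N γ, arith N γ → IsIntegral ℤ (M * (κ γ - κ₀)) ∧
      ∀ w : InfinitePlace K, w ≠ w₂ → w ≠ w₃ → w (κ γ - κ₀) ≤ B) :
    ∃ C' : ℝ, ∀ N (R : ℝ), 0 ≤ R → ∃ s : Finset Orb,
      (∀ γ, arith N γ → (1 + w₂ (κ γ - κ₀)) * (1 + w₃ (κ γ - κ₀)) ≤ R → γ ∈ s) ∧
      (s.card : ℝ) ≤ C' * (1 + R) ^ (1 + ε) := by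
  classical
  obtain ⟨C, hC0, hC⟩ := exists_finset_rpow hK M hM hw hε hB
  refine ⟨C, fun N R hR => ?_⟩
  by_cases hR1 : 1 ≤ R
  · obtain ⟨s, hs_mem, hs_card⟩ := hC R hR1
    -- pull back along the injective `κ`
    let f : Orb → K := fun γ => κ γ - κ₀
    have hf : Function.Injective f := fun γ γ' h => hκ (sub_left_injective h)
    refine ⟨s.preimage f hf.injOn, fun γ hγ hsize => ?_, ?_⟩
    · rw [Finset.mem_preimage]
      refine hs_mem _ ⟨(hdict N γ hγ).1, (hdict N γ hγ).2, hsize⟩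
    · have h1 : (s.preimage f hf.injOn).card ≤ s.card := by
        rw [Finset.card_preimage]
        exact Finset.card_filter_le _ _
      calc ((s.preimage f hf.injOn).card : ℝ) ≤ (s.card : ℝ) := by exact_mod_cast h1
        _ ≤ C * (1 + R) ^ (1 + ε) := hs_card
  · -- `R < 1`: the size is always `≥ 1`, so the set is empty
    refine ⟨∅, fun γ _ hsize => ?_, ?_⟩
    · exfalso
      have h2 : 1 ≤ 1 + w₂ (κ γ - κ₀) := by have := apply_nonneg w₂ (κ γ - κ₀); linarith
      have h3 : 1 ≤ 1 + w₃ (κ γ - κ₀) := by have := apply_nonneg w₃ (κ γ - κ₀); linarith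
      have : (1 : ℝ) ≤ (1 + w₂ (κ γ - κ₀)) * (1 + w₃ (κ γ - κ₀)) := by nlinarith
      exact hR1 (this.trans hsize)
    · simp only [Finset.card_empty, Nat.cast_zero]
      positivity

end Summit.Ventures.HodgeRepro2.Tier7.Line3.CountBoundOfKappa
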